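import Summits.Ventures.HodgeRepro2.T5SU11GaussLegendreConvergence
import Summits.Ventures.HodgeRepro2.T5SU11GaussLegendreWeights
import Summits.Ventures.HodgeRepro2.T5SU11LegendreSeries
import Summits.Ventures.HodgeRepro2.T5SU11LegendreBound

/-!
# The discrete Legendre transform: the Fourier–Legendre coefficients computed by the Gauss–Legendre rule

The `n`-point Gauss–Legendre rule (row 419) replaces the coefficient integrals by finite sums:

  `c̃_k(f) := ((2k + 1)/2) Σ_{i ∈ nodes n} w_i f(x_i) P_k(x_i)`   (`discreteCoeff n f k`).

Exactness on polynomials of degree `≤ 2n − 1` (row 408) gives **`c̃_k(p) = c_k(p)` whenever `deg p + k ≤ 2n − 1`**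
(`discreteCoeff_eq_fourierLegendre`), so every polynomial of degree `≤ n − 1` is reconstructed EXACTLY from its
`n` samples at the Gauss nodes, **`p = Σ_{k<n} c̃_k(p) P_k`** (`eval_eq_sum_discreteCoeff`), with the discrete
Parseval identity **`Σ_i w_i p(x_i)² = Σ_{k<n} 2 c̃_k(p)²/(2k + 1)`** (`gaussRule_sq_eq_sum`); the rule annihilates
`P_n` (`discreteCoeff_self_eq_zero`: `c̃_n(f) = 0` for every `f`), the discrete coefficients are stable
(`abs_discreteCoeff_le`: `|c̃_k(f)| ≤ (2k + 1) sup |f|`), and for every continuous `f` they converge to the true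
coefficients as the number of nodes grows, **`c̃_k(f) → c_k(f)`** (`tendsto_discreteCoeff`, Stieltjes' theorem
of row 419). Nothing is claimed about (N).

Blind lane: Mathlib + the HodgeRepro2 prefix only; no sorry; axioms ⊆ {propext, Classical.choice,
Quot.sound}.
-/

namespace Summit.Ventures.HodgeRepro2.T5SU11DiscreteLegendreTransform

open Polynomial intervalIntegral Finset Filter Topology MeasureTheory
open Set (Icc Ioo)
open T5SU11SphericalLegendreAll T5SU11JacobiPhaseLawEven T5SU11JacobiLegendreLeading T5SU11LegendreIdentities
  T5SU11LegendreOrthogonal T5SU11LegendreOrthogonalLower T5SU11LegendreBound T5SU11LegendreExpansion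
  T5SU11GaussLegendre T5SU11GaussLegendreWeights T5SU11GaussLegendreConvergence T5SU11LegendreSeries

/-- **The discrete Fourier–Legendre coefficient** `c̃_k(f) = ((2k + 1)/2) Σ_{i ∈ nodes n} w_i f(x_i) P_k(x_i)`. -/
noncomputable def discreteCoeff (n : ℕ) (f : ℝ → ℝ) (k : ℕ) : ℝ :=
  (2 * (k : ℝ) + 1) / 2 * gaussRule n (fun x => f x * legP k x)

/-! ### Exactness on polynomials -/

/-- **`c̃_k(p) = c_k(p)` whenever `deg p + k ≤ 2n − 1`** (the rule is exact on `p · P_k`). -/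
theorem discreteCoeff_eq_fourierLegendre {n : ℕ} (hn : 1 ≤ n) {p : ℝ[X]} {k : ℕ}
    (h : p.natDegree + k ≤ 2 * n - 1) :
    discreteCoeff n (fun x => p.eval x) k = fourierLegendre (fun x => p.eval x) k := by
  have e : (fun x => p.eval x * legP k x) = fun x => (p * legPoly k).eval x := by
    funext x
    rw [eval_mul, legP_eq_eval]
  have hdeg : (p * legPoly k).natDegree ≤ 2 * n - 1 :=
    (natDegree_mul_le).trans (by rw [natDegree_legPoly]; exact h)
  rw [discreteCoeff, fourierLegendre, e, gaussRule_eq_integral hn hdeg]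

/-- `c̃_k(p) = c_k(p)` for `deg p ≤ n − 1` and `k ≤ n − 1`. -/
theorem discreteCoeff_eq_fourierLegendre' {n : ℕ} (hn : 1 ≤ n) {p : ℝ[X]} (hp : p.natDegree ≤ n - 1) {k : ℕ}
    (hk : k ≤ n - 1) : discreteCoeff n (fun x => p.eval x) k = fourierLegendre (fun x => p.eval x) k :=
  discreteCoeff_eq_fourierLegendre hn (by omega)

/-- The discrete coefficient of a polynomial `p` of degree `≤ n − 1` is row 409's `legendreCoeff p k`
(`k ≤ n − 1`). -/
theorem discreteCoeff_eq_legendreCoeff {n : ℕ} (hn : 1 ≤ n) {p : ℝ[X]} (hp : p.natDegree ≤ n - 1) {k : ℕ}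
    (hk : k ≤ n - 1) : discreteCoeff n (fun x => p.eval x) k = legendreCoeff p k := by
  rw [discreteCoeff_eq_fourierLegendre' hn hp hk, fourierLegendre, legendreCoeff]

/-- **Exact reconstruction from `n` samples**: `p = Σ_{k<n} c̃_k(p) P_k` for every polynomial of degree `≤ n − 1`. -/
theorem eval_eq_sum_discreteCoeff {n : ℕ} (hn : 1 ≤ n) {p : ℝ[X]} (hp : p.natDegree ≤ n - 1) (x : ℝ) :
    p.eval x = ∑ k ∈ range n, discreteCoeff n (fun x => p.eval x) k * legP k x := by
  obtain ⟨m, rfl⟩ : ∃ m, n = m + 1 := ⟨n - 1, by omega⟩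
  simp only [Nat.add_sub_cancel] at hp
  rw [eval_eq_sum_legendreCoeff hp x]
  refine Finset.sum_congr rfl fun k hk => ?_
  rw [discreteCoeff_eq_legendreCoeff hn hp (by simp only [Nat.add_sub_cancel]; exact Nat.lt_succ_iff.mp (Finset.mem_range.mp hk))]

/-- **The discrete Parseval identity**: `Σ_i w_i p(x_i)² = Σ_{k<n} 2 c̃_k(p)²/(2k + 1)` for `deg p ≤ n − 1`. -/
theorem gaussRule_sq_eq_sum {n : ℕ} (hn : 1 ≤ n) {p : ℝ[X]} (hp : p.natDegree ≤ n - 1) :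
    gaussRule n (fun x => p.eval x ^ 2)
      = ∑ k ∈ range n, discreteCoeff n (fun x => p.eval x) k ^ 2 * (2 / (2 * (k : ℝ) + 1)) := by
  obtain ⟨m, rfl⟩ : ∃ m, n = m + 1 := ⟨n - 1, by omega⟩
  simp only [Nat.add_sub_cancel] at hp
  have e : (fun x => p.eval x ^ 2) = fun x => (p ^ 2).eval x := by funext x; rw [eval_pow]
  have hdeg : (p ^ 2).natDegree ≤ 2 * (m + 1) - 1 :=
    (natDegree_pow_le).trans (by omega)
  rw [e, gaussRule_eq_integral hn hdeg]
  simp_rw [eval_pow]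
  rw [integral_sq_eq_sum hp]
  refine Finset.sum_congr rfl fun k hk => ?_
  rw [discreteCoeff_eq_legendreCoeff hn hp (by simp only [Nat.add_sub_cancel]; exact Nat.lt_succ_iff.mp (Finset.mem_range.mp hk))]

/-- **Discrete orthogonality** in the language of the rule: `Q_n (P_k P_l) = 2δ_{kl}/(2k + 1)` for `k, l ≤ n − 1`. -/
theorem gaussRule_legP_mul_legP {n : ℕ} (hn : 1 ≤ n) {k l : ℕ} (hk : k ≤ n - 1) (hl : l ≤ n - 1) :
    gaussRule n (fun x => legP k x * legP l x) = if k = l then 2 / (2 * (k : ℝ) + 1) else 0 := by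
  obtain ⟨m, rfl⟩ : ∃ m, n = m + 1 := ⟨n - 1, by omega⟩
  simp only [Nat.add_sub_cancel] at hk hl
  exact sum_weight_mul_legP_mul_legP (card_nodes (m + 1)) (fun _ hr => legP_eq_zero_of_mem_nodes hr) hk hl

/-! ### The rule annihilates `P_n`; stability; convergence -/

/-- **`c̃_n(f) = 0` for every `f`**: the `n`-point rule annihilates `P_n` (all nodes are zeros of `P_n`). -/
theorem discreteCoeff_self_eq_zero (n : ℕ) (f : ℝ → ℝ) : discreteCoeff n f n = 0 := by
  rw [discreteCoeff, gaussRule]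
  rw [Finset.sum_eq_zero fun i hi => by rw [legP_eq_zero_of_mem_nodes hi, mul_zero, mul_zero], mul_zero]

/-- **Stability**: `|c̃_k(f)| ≤ (2k + 1) C` whenever `|f| ≤ C` on `(−1, 1)` (`n ≥ 1`). -/
theorem abs_discreteCoeff_le {n : ℕ} (hn : 1 ≤ n) {f : ℝ → ℝ} {C : ℝ} (hf : ∀ x ∈ Ioo (-1 : ℝ) 1, |f x| ≤ C)
    (k : ℕ) : |discreteCoeff n f k| ≤ (2 * (k : ℝ) + 1) * C := by
  have hC : 0 ≤ C := (abs_nonneg _).trans (hf 0 (by norm_num))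
  have h := abs_gaussRule_le hn (f := fun x => f x * legP k x) (C := C) fun x hx => by
    rw [abs_mul]
    calc |f x| * |legP k x| ≤ C * 1 :=
          mul_le_mul (hf x hx) (abs_legP_le_one k (Set.Ioo_subset_Icc_self hx)) (abs_nonneg _) hC
      _ = C := mul_one C
  rw [discreteCoeff, abs_mul, abs_of_pos (by positivity : (0 : ℝ) < (2 * (k : ℝ) + 1) / 2)]
  calc (2 * (k : ℝ) + 1) / 2 * |gaussRule n fun x => f x * legP k x| ≤ (2 * (k : ℝ) + 1) / 2 * (2 * C) :=
        mul_le_mul_of_nonneg_left h (by positivity)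
    _ = (2 * (k : ℝ) + 1) * C := by ring

/-- **Convergence of the discrete transform**: `c̃_k(f) → c_k(f)` as `n → ∞` for every `f` continuous on
`[−1, 1]` (Stieltjes' theorem, row 419, applied to `f · P_k`). -/
theorem tendsto_discreteCoeff {f : ℝ → ℝ} (hf : ContinuousOn f (Icc (-1 : ℝ) 1)) (k : ℕ) :
    Tendsto (fun n => discreteCoeff n f k) atTop (𝓝 (fourierLegendre f k)) := by
  have h := tendsto_gaussRule (f := fun x => f x * legP k x) (hf.mul (continuous_legP k).continuousOn)
  exact h.const_mul ((2 * (k : ℝ) + 1) / 2)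

/-- The discrete partial sums `Σ_{k ≤ d} c̃_k(f) P_k(x)` converge to `S_d f(x)` as the number of nodes grows. -/
theorem tendsto_sum_discreteCoeff_mul_legP {f : ℝ → ℝ} (hf : ContinuousOn f (Icc (-1 : ℝ) 1)) (d : ℕ) (x : ℝ) :
    Tendsto (fun n => ∑ k ∈ range (d + 1), discreteCoeff n f k * legP k x) atTop (𝓝 (partialSum f d x)) := by
  rw [partialSum]
  exact tendsto_finsetSum _ fun k _ => (tendsto_discreteCoeff hf k).mul_const _

end Summit.Ventures.HodgeRepro2.T5SU11DiscreteLegendreTransform
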